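import Literature.NumberTheory.LFunctions.DirichletLFunctionInverseBound
import HarnessLib

/-!
# Neutralisation of the Eisenstein weight `1/|L(1+2it,χ)|²` at the Siegel point `t = 0`
# (first rung of the §D fam card `siegel-point-annihilation`; MV Theorem 11.4 on the line σ = 1)

Topic `Literature/NumberTheory/LFunctions` (namespace `Literature.NumberTheory.LFunctions.SiegelPoint`).
Cell `landau-siegel`, §D typer (edge fam = the ½-proportion edge), card `siegel-point-annihilation`
(ls-knife-fam-idea-1, filed 2026-08-27T00:27Z; draft `knife/fam/idea-1/CARD-…`, Sketch
`Sketch-siegel-point-annihilation.lean`). PROOFS only — every statement below is a kernel theorem;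
no named fact is introduced (the card's P1 «MV Thm 11.4 (11.10)» is already PROVED in the tree:
`DirichletZFR.exists_inv_LFunction_bounds`).

The card's mechanism in one line (its `SiegelPointNeutralisation`, «K0 + P2 combined»): in a
restricted level average the exceptional character `χ = χ_D` enters the spectral side through the
`χ`-Eisenstein normaliser `1/|L(1+2it,χ)|²`, whose only bad point is the Siegel point `t = 0`; if
the PAIRING `P(t)` against that Eisenstein packet VANISHES at `t = 0` and is `B`-Lipschitz on
`[−1,1]`, then `∫_{−1}^{1} |P(t)|²/|L(1+2it,χ)|² dt ≤ C·B²·(1 + log² q)` with an ABSOLUTE `C` —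
no lower bound for `L(1,χ)` enters (effective, «world-continuous»).

Contents:
* `norm_LFunction_one_add_ge` (the card's K0 in the form the tree's MV 11.4 yields): there is an
  absolute `c > 0` with `‖L(1+2it,χ)‖ ≥ c·|t|/log q` for `q ≥ 2`, `χ ≠ χ₀ mod q`, `0 < |t| ≤ 1` —
  from `exists_inv_LFunction_bounds` (A) [(11.7): `1/L ≪ ℒ`] and (B) [(11.10):
  `1/L ≪ ℒ(1 + 1/|s − β₁|)` with `|s − β₁| ≥ 2|t|`]. (MV's printed (11.7) gives the sharper
  `min(|t|, 1/log q)`, the card's `SiegelPointLowerBound`; the weaker `|t|/log q` already suffices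
  for the neutralisation bound, whose right-hand side is `≍ B² log² q` either way.)
* `integral_sq_div_sq_le` (the card's P2, pure real analysis, slightly stronger hypothesis form
  `c|t|/ℓ ≤ w(t)`): `P(0) = 0`, `P` `B`-Lipschitz on `[−1,1]`, `w ≥ 0`, `w(t) ≥ c|t|/ℓ` for
  `t ≠ 0` ⇒ `∫_{−1}^{1} ‖P‖²/w² ≤ (B/c)²·2ℓ²`; and the card's exact P2 `annihilatedEisensteinWeight`
  (`w(t) ≥ c·min(|t|, 1/ℓ)`, `ℓ ≥ 1` ⇒ `≤ (B/c)²(2 + 2ℓ²)`).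
* `siegelPointNeutralisation` — the card's typed rung (the body of the Sketch's
  `def SiegelPointNeutralisation : Prop`, l. 75) as a kernel THEOREM.

WHAT THIS IS NOT: nothing here touches the card's cruxes K1 (dihedral packet bound), K2 (cost
lemma), K3 (GAP-2 bracket), which are NOT typed in this file; no claim about the ½-proportion edge.
«The programme SEARCHES and TYPES; no claim about Landau–Siegel zeros, Theorems 1–2 of
arXiv:2211.02515 or a repaired Margin232 until a kernel theorem says so.»

## References

* [MontgomeryVaughan2007] H. L. Montgomery, R. C. Vaughan, *Multiplicative Number Theory I*,
  CUP (2007), §11.1 Theorem 11.4, (11.7) and (11.10), p. 277 (held: p0277:L39–L60, read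
  2026-08-27).
* Tree: `Literature.NumberTheory.LFunctions.DirichletZFR.exists_inv_LFunction_bounds`
  (`DirichletLFunctionInverseBound.lean`).
-/

noncomputable section

open Complex Set MeasureTheory intervalIntegral

namespace Literature.NumberTheory.LFunctions.SiegelPoint

/-! ## K0 — the lower bound for `|L(1+2it,χ)|` on `0 < |t| ≤ 1` (MV Theorem 11.4 on the line) -/

/-- `log q + log(|2t| + 4) ≤ 4 log q` for `q ≥ 2`, `|t| ≤ 1` (`log 6 ≤ log 8 = 3 log 2`).
[cite: MontgomeryVaughan2007, Theorem 11.4 (notation ℒ = log qτ)] -/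
private theorem ell_le_four_log {q : ℕ} (hq : 2 ≤ q) {t : ℝ} (ht : |t| ≤ 1) :
    Real.log q + Real.log (|2 * t| + 4) ≤ 4 * Real.log q := by
  have hq' : (2 : ℝ) ≤ q := by exact_mod_cast hq
  have hlog2 : Real.log 2 ≤ Real.log q := Real.log_le_log (by norm_num) hq'
  have h6 : |2 * t| + 4 ≤ 8 := by
    rw [abs_mul, abs_of_pos (by norm_num : (0:ℝ) < 2)]; linarith
  have hl6 : Real.log (|2 * t| + 4) ≤ Real.log 8 :=
    Real.log_le_log (by positivity) h6
  have hl8 : Real.log 8 = 3 * Real.log 2 := by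
    rw [show (8 : ℝ) = 2 ^ 3 by norm_num, Real.log_pow]; norm_num
  linarith

/-- `log q + log(|2t| + 4) > 0` for `q ≥ 1`. [cite: MontgomeryVaughan2007, Theorem 11.4 (notation ℒ = log qτ)] -/
private theorem ell_pos {q : ℕ} (hq : 1 ≤ q) (t : ℝ) :
    0 < Real.log q + Real.log (|2 * t| + 4) := by
  have h1 : 0 ≤ Real.log q := Real.log_nonneg (by exact_mod_cast hq)
  have h2 : 0 < Real.log (|2 * t| + 4) := Real.log_pos (by linarith [abs_nonneg (2 * t)])
  linarith

/-- **K0 (MV Theorem 11.4 on the line `σ = 1`).** There is an absolute `c > 0` such that for every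
`q ≥ 2`, every non-principal `χ mod q` and every real `t` with `0 < |t| ≤ 1`:
`c · |t| / log q ≤ ‖L(1 + 2it, χ)‖`. Case (A) of `exists_inv_LFunction_bounds` (no exceptional
zero, (11.7): `‖1/L‖ ≤ C ℒ`) and case (B) (an exceptional zero `β₁`, (11.10):
`‖1/L‖ ≤ C ℒ (1 + 1/‖s − β₁‖)` with `‖s − β₁‖ ≥ |Im s| = 2|t|`), `ℒ ≤ 4 log q`. No lower bound for
`L(1,χ)` is used: the exceptional zero only costs the factor `|t|`.
[cite: MontgomeryVaughan2007, Theorem 11.4 (11.7) and (11.10)] -/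
theorem norm_LFunction_one_add_ge :
    ∃ c : ℝ, 0 < c ∧ ∀ (q : ℕ) [NeZero q], 2 ≤ q → ∀ χ : DirichletCharacter ℂ q, χ ≠ 1 →
      ∀ t : ℝ, 0 < |t| → |t| ≤ 1 →
        c * |t| / Real.log q ≤ ‖χ.LFunction (1 + 2 * t * I)‖ := by
  obtain ⟨c, hc, -, C, hC0, -, -, hA, hB⟩ := DirichletZFR.exists_inv_LFunction_bounds
  set C' : ℝ := C + 1 with hC'
  have hC'pos : 0 < C' := by positivity
  refine ⟨(6 * C')⁻¹, by positivity, fun q _ hq χ hχ t ht0 ht1 => ?_⟩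
  have hq1 : 1 ≤ q := le_trans (by norm_num) hq
  have hlogq : 0 < Real.log q := Real.log_pos (by exact_mod_cast (lt_of_lt_of_le one_lt_two hq))
  set s : ℂ := 1 + 2 * t * I with hs
  have hsre : s.re = 1 := by simp [hs]
  have hsim : s.im = 2 * t := by simp [hs]
  have hL : 0 < Real.log q + Real.log (|s.im| + 4) := by rw [hsim]; exact ell_pos hq1 t
  have hL4 : Real.log q + Real.log (|s.im| + 4) ≤ 4 * Real.log q := by
    rw [hsim]; exact ell_le_four_log hq ht1
  have hreg : 1 - c / (Real.log q + Real.log (|s.im| + 4)) ≤ s.re := by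
    rw [hsre]; have : 0 < c / (Real.log q + Real.log (|s.im| + 4)) := div_pos hc hL; linarith
  -- the bound `‖L⁻¹‖ ≤ 6 C' log q / |t|` in both cases
  have key : χ.LFunction s ≠ 0 ∧ ‖(χ.LFunction s)⁻¹‖ ≤ 6 * C' * Real.log q / |t| := by
    have h23 : (1 : ℝ) ≤ 3 / (2 * |t|) := by
      rw [le_div_iff₀ (by positivity)]; linarith
    by_cases hex : ∃ β : ℝ, χ.LFunction β = 0 ∧ 1 - 2 * c / (Real.log q + Real.log 4) < β
    · obtain ⟨β, hβ0, hβ⟩ := hex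
      obtain ⟨-, -, hBs⟩ := hB q χ hχ β hβ0 hβ
      have hsβ : s ≠ (β : ℂ) := by
        intro h
        have := congrArg Complex.im h
        rw [hsim, Complex.ofReal_im] at this
        have : t = 0 := by linarith
        exact (ne_of_gt ht0) (by rw [this, abs_zero])
      obtain ⟨hne, hle⟩ := hBs s hreg hsβ
      refine ⟨hne, le_trans hle ?_⟩
      have hdist : 2 * |t| ≤ ‖s - β‖ := by
        have h1 : |(s - β).im| ≤ ‖s - (β : ℂ)‖ := Complex.abs_im_le_norm _
        have h2 : (s - (β : ℂ)).im = 2 * t := by simp [hsim]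
        rw [h2, abs_mul, abs_of_pos (by norm_num : (0:ℝ) < 2)] at h1
        exact h1
      have hfac : 1 + ‖s - (β : ℂ)‖⁻¹ ≤ 3 / (2 * |t|) := by
        have hinv : ‖s - (β : ℂ)‖⁻¹ ≤ (2 * |t|)⁻¹ :=
          inv_anti₀ (by positivity) hdist
        have hone : 1 ≤ |t|⁻¹ := one_le_inv_iff₀.mpr ⟨ht0, ht1⟩
        have hsplit : 3 / (2 * |t|) = (2 * |t|)⁻¹ + |t|⁻¹ := by
          field_simp; ring
        rw [hsplit]
        linarith
      have hfac0 : 0 ≤ 1 + ‖s - (β : ℂ)‖⁻¹ :=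
        add_nonneg zero_le_one (inv_nonneg.mpr (norm_nonneg _))
      have h1 : C * (Real.log q + Real.log (|s.im| + 4)) ≤ C' * (4 * Real.log q) :=
        mul_le_mul (by linarith) hL4 hL.le hC'pos.le
      calc C * (Real.log q + Real.log (|s.im| + 4)) * (1 + ‖s - (β : ℂ)‖⁻¹)
          ≤ C' * (4 * Real.log q) * (3 / (2 * |t|)) :=
            mul_le_mul h1 hfac hfac0 (by positivity)
        _ = 6 * C' * Real.log q / |t| := by field_simp; ring
    · push Not at hex
      obtain ⟨hne, hle⟩ := hA q χ hχ (fun β hβ => hex β hβ) s hreg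
      refine ⟨hne, le_trans hle ?_⟩
      have h1 : C * (Real.log q + Real.log (|s.im| + 4)) ≤ C' * (4 * Real.log q) :=
        mul_le_mul (by linarith) hL4 hL.le hC'pos.le
      calc C * (Real.log q + Real.log (|s.im| + 4))
          ≤ C' * (4 * Real.log q) * 1 := by rw [mul_one]; exact h1
        _ ≤ C' * (4 * Real.log q) * (3 / (2 * |t|)) :=
            mul_le_mul_of_nonneg_left h23 (by positivity)
        _ = 6 * C' * Real.log q / |t| := by field_simp; ring
  obtain ⟨hne, hle⟩ := key
  have hM : 0 < 6 * C' * Real.log q / |t| := by positivity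
  have hnorm : 0 < ‖χ.LFunction s‖ := norm_pos_iff.mpr hne
  rw [norm_inv] at hle
  -- `‖L‖⁻¹ ≤ M` ⇒ `M⁻¹ ≤ ‖L‖`
  have := inv_le_of_inv_le₀ hnorm hle
  calc (6 * C')⁻¹ * |t| / Real.log q = (6 * C' * Real.log q / |t|)⁻¹ := by
        field_simp
    _ ≤ ‖χ.LFunction s‖ := this

/-! ## P2 — the decoupling inequality (pure real analysis) -/

/-- **P2 (strong hypothesis form).** If `P(0) = 0`, `P` is `B`-Lipschitz on `[−1,1]`, the weight
`w ≥ 0` satisfies `w(t) ≥ c|t|/ℓ` for `t ∈ [−1,1] ∖ {0}` (`c, ℓ > 0`), then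
`∫_{−1}^{1} ‖P(t)‖²/w(t)² dt ≤ (B/c)² · 2ℓ²` (no sign condition on `w` or `B` is needed): pointwise `‖P(t)‖ ≤ B|t|` and
`‖P‖²/w² ≤ B²t²ℓ²/(c²t²) = (Bℓ/c)²` (and `0` at `t = 0`), integrated over an interval of length `2`
(if the integrand is not integrable the interval integral is `0` by convention and the bound holds
trivially). [cite: MontgomeryVaughan2007, Theorem 11.4 (11.10) (use of)] -/
theorem integral_sq_div_sq_le {P : ℝ → ℂ} {w : ℝ → ℝ} {B c ℓ : ℝ} (hc : 0 < c) (hℓ : 0 < ℓ)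
    (hP0 : P 0 = 0)
    (hLip : ∀ t ∈ Icc (-1 : ℝ) 1, ∀ s ∈ Icc (-1 : ℝ) 1, ‖P t - P s‖ ≤ B * |t - s|)
    (hw : ∀ t ∈ Icc (-1 : ℝ) 1, t ≠ 0 → c * |t| / ℓ ≤ w t) :
    ∫ t in (-1 : ℝ)..1, ‖P t‖ ^ 2 / (w t) ^ 2 ≤ (B / c) ^ 2 * (2 * ℓ ^ 2) := by
  set K : ℝ := (B * ℓ / c) ^ 2 with hK
  -- pointwise bound on `[−1, 1]`
  have hpt : ∀ t ∈ Icc (-1 : ℝ) 1, ‖P t‖ ^ 2 / (w t) ^ 2 ≤ K := by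
    intro t ht
    by_cases ht0 : t = 0
    · subst ht0
      rw [hP0, norm_zero]
      simp only [ne_eq, OfNat.ofNat_ne_zero, not_false_eq_true, zero_pow, zero_div]
      positivity
    · have hPt : ‖P t‖ ≤ B * |t| := by
        have := hLip t ht 0 ⟨by norm_num, by norm_num⟩
        rwa [hP0, sub_zero, sub_zero] at this
      have hwt : c * |t| / ℓ ≤ w t := hw t ht ht0
      have hct : 0 < c * |t| / ℓ := by
        have : 0 < |t| := abs_pos.mpr ht0
        positivity
      have hwpos : 0 < w t := lt_of_lt_of_le hct hwt
      rw [div_le_iff₀ (by positivity)]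
      have h1 : ‖P t‖ ^ 2 ≤ (B * |t|) ^ 2 := pow_le_pow_left₀ (norm_nonneg _) hPt 2
      have h2 : (c * |t| / ℓ) ^ 2 ≤ (w t) ^ 2 := pow_le_pow_left₀ hct.le hwt 2
      have h3 : (B * |t|) ^ 2 = K * (c * |t| / ℓ) ^ 2 := by
        rw [hK]; field_simp
      calc ‖P t‖ ^ 2 ≤ (B * |t|) ^ 2 := h1
        _ = K * (c * |t| / ℓ) ^ 2 := h3
        _ ≤ K * (w t) ^ 2 := by gcongr
  have hKval : (B / c) ^ 2 * (2 * ℓ ^ 2) = ∫ _ in (-1 : ℝ)..1, K := by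
    rw [intervalIntegral.integral_const, hK]
    simp only [smul_eq_mul]
    ring
  rw [hKval]
  by_cases hint : IntervalIntegrable (fun t => ‖P t‖ ^ 2 / (w t) ^ 2) volume (-1) 1
  · exact intervalIntegral.integral_mono_on (by norm_num) hint intervalIntegrable_const hpt
  · rw [intervalIntegral.integral_undef hint, intervalIntegral.integral_const]
    simp only [smul_eq_mul]
    have : 0 ≤ K := by positivity
    nlinarith

/-- **The card's P2 verbatim** (`AnnihilatedEisensteinWeight`, Sketch l. 33): `P(0) = 0`, `P`
`B`-Lipschitz on `[−1,1]`, weight `w ≥ 0` with `w(t) ≥ c·min(|t|, 1/ℓ)` off `0` (`c > 0`,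
`ℓ ≥ 1`) ⇒ `∫_{−1}^{1} ‖P‖²/w² ≤ (B/c)²(2 + 2ℓ²)`. (For `|t| ≤ 1 ≤ ℓ`, `min(|t|,1/ℓ) ≥ |t|/ℓ`,
so this follows from `integral_sq_div_sq_le`.) [cite: MontgomeryVaughan2007, Theorem 11.4 (11.10) (use of)] -/
theorem annihilatedEisensteinWeight (P : ℝ → ℂ) (w : ℝ → ℝ) (B c ℓ : ℝ) (hc : 0 < c)
    (hℓ : 1 ≤ ℓ) (_hB : 0 ≤ B) (hP0 : P 0 = 0)
    (hLip : ∀ t ∈ Icc (-1 : ℝ) 1, ∀ s ∈ Icc (-1 : ℝ) 1, ‖P t - P s‖ ≤ B * |t - s|)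
    (hw : ∀ t ∈ Icc (-1 : ℝ) 1, t ≠ 0 → c * min |t| (1 / ℓ) ≤ w t) (_hw0 : ∀ t, 0 ≤ w t) :
    ∫ t in (-1 : ℝ)..1, ‖P t‖ ^ 2 / (w t) ^ 2 ≤ (B / c) ^ 2 * (2 + 2 * ℓ ^ 2) := by
  have hℓ0 : 0 < ℓ := lt_of_lt_of_le one_pos hℓ
  have hw' : ∀ t ∈ Icc (-1 : ℝ) 1, t ≠ 0 → c * |t| / ℓ ≤ w t := by
    intro t ht ht0
    refine le_trans ?_ (hw t ht ht0)
    rw [mul_div_assoc]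
    refine mul_le_mul_of_nonneg_left ?_ hc.le
    have hat : |t| ≤ 1 := abs_le.mpr ⟨by linarith [ht.1], ht.2⟩
    refine le_min ?_ ?_
    · rw [div_le_iff₀ hℓ0]
      calc |t| = |t| * 1 := (mul_one _).symm
        _ ≤ |t| * ℓ := by gcongr
    · exact div_le_div_of_nonneg_right hat hℓ0.le
  calc ∫ t in (-1 : ℝ)..1, ‖P t‖ ^ 2 / (w t) ^ 2 ≤ (B / c) ^ 2 * (2 * ℓ ^ 2) :=
        integral_sq_div_sq_le hc hℓ0 hP0 hLip hw'
    _ ≤ (B / c) ^ 2 * (2 + 2 * ℓ ^ 2) := by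
        have : 0 ≤ (B / c) ^ 2 := by positivity
        nlinarith

/-! ## The typed rung: Siegel-point neutralisation -/

/-- **The card's typed rung, verbatim, as a theorem** (the body of the Sketch's
`def SiegelPointNeutralisation : Prop`, l. 75 — «K0 + P2 combined = the card's mechanism in one
line; EFFECTIVE EISENSTEIN NEUTRALISATION at the Siegel point»; the Sketch's `Prop` is closed by
`exact siegelPointNeutralisation`): there is an absolute `C > 0` such that for every `q ≥ 2`, every
non-trivial `χ mod q` and every pairing `P` with `P 0 = 0` that is `B`-Lipschitz on `[−1,1]`,
`∫_{−1}^{1} ‖P t‖² / ‖L(1+2it,χ)‖² dt ≤ C · B² · (1 + (log q)²)` — no lower bound for `L(1,χ)`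
enters. Proof: `C = 2/c²` with `c` the constant of `norm_LFunction_one_add_ge`; the weight
`w(t) = ‖L(1+2it,χ)‖ ≥ c|t|/log q` feeds `integral_sq_div_sq_le` with `ℓ = log q`, giving
`≤ (B/c)²·2 log² q ≤ (2/c²)·B²·(1 + log² q)`.
[cite: MontgomeryVaughan2007, Theorem 11.4 (11.7) and (11.10)] -/
theorem siegelPointNeutralisation :
    ∃ C : ℝ, 0 < C ∧ ∀ (q : ℕ) [NeZero q], 2 ≤ q → ∀ χ : DirichletCharacter ℂ q, χ ≠ 1 →
      ∀ (P : ℝ → ℂ) (B : ℝ), 0 ≤ B → P 0 = 0 →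
        (∀ t ∈ Set.Icc (-1 : ℝ) 1, ∀ s ∈ Set.Icc (-1 : ℝ) 1, ‖P t - P s‖ ≤ B * |t - s|) →
        ∫ t in (-1 : ℝ)..1, ‖P t‖ ^ 2 / ‖DirichletCharacter.LFunction χ (1 + 2 * t * I)‖ ^ 2
          ≤ C * B ^ 2 * (1 + Real.log q ^ 2) := by
  obtain ⟨c, hc, hK0⟩ := norm_LFunction_one_add_ge
  refine ⟨2 / c ^ 2, by positivity, fun q _ hq χ hχ P B _ hP0 hLip => ?_⟩
  have hlogq : 0 < Real.log q := Real.log_pos (by exact_mod_cast (lt_of_lt_of_le one_lt_two hq))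
  have hw : ∀ t ∈ Icc (-1 : ℝ) 1, t ≠ 0 →
      c * |t| / Real.log q ≤ ‖χ.LFunction (1 + 2 * t * I)‖ := by
    intro t ht ht0
    exact hK0 q hq χ hχ t (abs_pos.mpr ht0) (abs_le.mpr ⟨by linarith [ht.1], ht.2⟩)
  calc ∫ t in (-1 : ℝ)..1, ‖P t‖ ^ 2 / ‖χ.LFunction (1 + 2 * t * I)‖ ^ 2
      ≤ (B / c) ^ 2 * (2 * Real.log q ^ 2) :=
        integral_sq_div_sq_le hc hlogq hP0 hLip hw
    _ = 2 / c ^ 2 * B ^ 2 * Real.log q ^ 2 := by field_simp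
    _ ≤ 2 / c ^ 2 * B ^ 2 * (1 + Real.log q ^ 2) := by
        have : 0 ≤ 2 / c ^ 2 * B ^ 2 := by positivity
        nlinarith

end Literature.NumberTheory.LFunctions.SiegelPoint

end
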